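/- Copyright: the b2b-balaban cell (near-miss cell 7), T⁴-continuum fan-out, NE7b swarm leaf 04 (gen 6; road W-RP, sub-row
«W3i»: the two-level law (fine field, block average) in plain coordinates).  Released under the licence of the
surrounding project. -/
import Summits.QuantumFields.BalabanUV.T4Continuum.Support.HistoryRPAveraging

/-!
# History chessboard road: the TWO-LEVEL LAW `(U, Ū)` in plain coordinates is reflection positive (W3i)

Summits-side support leaf of the T⁴-continuum cell (rung (B)+1 on a FINITE torus only; NOT infinite volume, NOT the
mass gap, NOT the Clay statement; NOT a proof of the spine estimate NE7b).  Road W-RP (R-OWNER-23-2 ∕ R-OWNER-23-8) of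
the swarm claim table `t4/b2b-balaban-t4-ne7b-p1/LEAVES-NE7b.md`, sub-row «W3i» (journal INTENT of leaf-04 g6), on top
of W3f (`HistoryRPHalfTorus`, `HistoryRPAveraging`).  [folklore] measure-theoretic transport; imports
`HistoryRPAveraging` only; no `structure`, no `[cite:]` tag, no `Prop`-valued definition (c1: `glue`, `twoLevel` are
DATA), no constant (c2∕c6), no exit ∕ socket ∕ `HistoryConstants` file (c3); nothing printed asserted.

WHY.  W3f's one-level package lives on W3b's technical carrier
`(GaugeField P j G × ((↥posBonds → G) × (↥posBonds → G))) × (↥crossBonds → G)` — the fine field, the reflected pair of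
positive-half read-outs, the crossing read-out.  The event readers of the road (W4b ∕ W4b′ ∕ W5) and any iteration want
the state in PLAIN coordinates: the joint law `μ.map (U ↦ (U, av.avg U))` of the fine field and its block average on
`GaugeField P j G × GaugeField P (j+1) G`, positive σ-algebra = positive FINE bonds + positive COARSE bonds
(`(mPos G j ρ).prod (mPos G (j+1) ρ)`), reflection `(U, V) ↦ (c_ρ U, c_ρ V)`.  This file is that transport.

WHAT.
* §1 [Mathlib-generic] `isReflectionPositiveBdd_map`: reflection positivity transports along a measurable map `Φ`
  that intertwines the reflections and reads positive data positively (`∫ (g∘Θ')·g d(ν.map Φ) = ∫ ((g∘Φ)∘Θ)·(g∘Φ) dν`);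
  `measurePreserving_map_of_semiconj`; `prod_le_prod` (monotonicity of the product σ-algebra).
* §2 `glue ρ w : GaugeField P (j+1) G` — re-assembling a coarse field from W3b's coordinates `w = ((y₊, y₋), z)`:
  positive bonds from `y₊`, crossing bonds from `z`, a NEGATIVE bond `c` from `(y₋ ⟨c_ρ c⟩)^{∓1}` (`cbond_mem_posBonds`);
  the three evaluation lemmas; `measurable_glue`; **`glue_reads`**: under centre-reflection equivariance (R),
  `glue ρ ((posRead ρ av U, posRead ρ av (c_ρ U)), crossRead ρ av (U, ·)) = av.avg U`; **`creflect_glue`**: `c_ρ (glue w)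
  = glue ((y₋, y₊), crossRefl z)` (the coarse reflection IS W3b's «swap the pair, `τ` the crossing data»).
* §3 `twoLevel ρ q := (q.1.1, glue ρ (q.1.2, q.2))`: measurable, intertwines W3d's reflection with
  `Prod.map (c_ρ) (c_ρ)` (`twoLevel_semiconj`), reads positive data positively (`measurable_twoLevel_pos`), and
  **THE STATE IDENTITY `map_twoLevel`**: `((μ ⊗ₘ (δ_f ×ₖ δ_f.comap θ)) ⊗ₘ δ_g).map (twoLevel ρ) = μ.map (U ↦ (U, av.avg U))`
  (Mathlib `Measure.compProd_deterministic` + W3d's `pairKernel_deterministic` + `glue_reads`) — the δ-extended state of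
  W3b∕W3d∕W3f IS the two-level law.
* §4 **`rpPackage_twoLevel`** (abstract measurable `av : Setup.Averaging` with `TwoBlockLocal av` + (R)) and
  **`rpPackage_twoLevel_blockAvg`** (Bałaban's (0.4), tree `blockAvg ℰ`): the FIVE-member RP-package of
  `μ.map (U ↦ (U, av.avg U))` for `(mPos G j ρ).prod (mPos G (j+1) ρ)` and `Prod.map (c_ρ) (c_ρ)`, from the SAME two base
  binders as W3f: `MeasurePreserving (creflect ρ) μ μ` and `IsReflectionPositiveBdd μ (mPos G j ρ) (creflect ρ)`.
  In words: if the fine state is reflection positive at the centre cut, so is the joint law of the fine field and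
  its block average (0.4), for the positive fine + coarse bonds.

HONEST SCOPE.  A transport∕re-packaging step over W3f; one level, centre cut; the base package in `Setup` words (W3h),
the other cuts (W3g), the K-fold tower, (EXT)∕(LOC)-for-events, (R-sym), (U1)∕(G2) stay displayed; the typing
identification «`blockAvg ℰ` is Bałaban's (0.4)» is T-class as everywhere in the cell.  NE7b NOT proved; spine 0∕9.
HONEST DEPENDENCY (cell): continuum YM on T⁴ ⇐ BetaPertH ∧ nine spine estimates (0/9 proved); BetaPertH ⇐ (D1) ∧ (D4)
∧ CAP+tail; G-an2-4 gates asym, D1 and NE2/3/4.  This file changes none of it. -/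

open MeasureTheory ProbabilityTheory
open Literature.MathematicalPhysics.QuantumFieldTheory.Balaban1983to89
open Literature.MathematicalPhysics.QuantumFieldTheory.LatticeRP (IsReflectionPositiveBdd)
open BlockAveraging T4ReflectionConeSharp
open Summit.QuantumFields.BalabanUV.T4Continuum.HistoryRPHalfTorus
open Summit.QuantumFields.BalabanUV.T4Continuum.HistoryRPAveraging

namespace Summit.QuantumFields.BalabanUV.T4Continuum.HistoryRPTwoLevel

noncomputable section

/-! ## §1 Transport of reflection positivity along an intertwining map -/

/-- The product σ-algebra is monotone in both factors. [folklore] -/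
theorem prod_le_prod {X X' : Type*} {m₁ m₁' : MeasurableSpace X} {m₂ m₂' : MeasurableSpace X'} (h₁ : m₁ ≤ m₁')
    (h₂ : m₂ ≤ m₂') : m₁.prod m₂ ≤ m₁'.prod m₂' :=
  sup_le_sup (MeasurableSpace.comap_mono h₁) (MeasurableSpace.comap_mono h₂)

section Transport

variable {X X' : Type*} {mQ : MeasurableSpace X} {mQ' : MeasurableSpace X'} [MeasurableSpace X] [MeasurableSpace X']

/-- **RP TRANSPORTS ALONG AN INTERTWINING MAP**: if `Φ` is measurable, reads `mQ'`-data through `mQ`-data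
(`Measurable[mQ, mQ'] Φ`) and intertwines the reflections (`Φ ∘ Θ = Θ' ∘ Φ`), then the pushforward of a state
reflection positive for `(mQ, Θ)` is reflection positive for `(mQ', Θ')`. [folklore] -/
theorem isReflectionPositiveBdd_map (hmQ' : mQ' ≤ (inferInstance : MeasurableSpace X')) {ν : Measure X}
    {Θ : X → X} {Θ' : X' → X'} (hΘ' : Measurable Θ') {Φ : X → X'} (hΦ : Measurable Φ)
    (hΦQ : @Measurable X X' mQ mQ' Φ) (hcomm : ∀ x, Φ (Θ x) = Θ' (Φ x)) (hRP : IsReflectionPositiveBdd ν mQ Θ) :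
    IsReflectionPositiveBdd (ν.map Φ) mQ' Θ' := by
  intro g hg hgb
  have hgm : Measurable g := hg.mono hmQ' le_rfl
  have hint : Measurable fun x' => g (Θ' x') * g x' := (hgm.comp hΘ').mul hgm
  rw [integral_map hΦ.aemeasurable hint.aestronglyMeasurable]
  obtain ⟨C, hC⟩ := hgb
  have h := hRP (g ∘ Φ) (hg.comp hΦQ) ⟨C, fun x => hC (Φ x)⟩
  simp only [Function.comp_apply, hcomm] at h
  exact h

/-- A measure-preserving map descends along an intertwining pushforward. [folklore] -/
theorem measurePreserving_map_of_semiconj {ν : Measure X} {Θ : X → X} {Θ' : X' → X'}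
    (hΘ : MeasurePreserving Θ ν ν) (hΘ' : Measurable Θ') {Φ : X → X'} (hΦ : Measurable Φ)
    (hcomm : ∀ x, Φ (Θ x) = Θ' (Φ x)) : MeasurePreserving Θ' (ν.map Φ) (ν.map Φ) := by
  refine ⟨hΘ', ?_⟩
  rw [Measure.map_map hΘ' hΦ, show Θ' ∘ Φ = Φ ∘ Θ from funext fun x => (hcomm x).symm,
    ← Measure.map_map hΦ hΘ.measurable, hΘ.map_eq]

end Transport

/-! ## §2 Re-assembling a coarse field from W3b's coordinates -/

section Glue

variable {P : Params} {j : ℕ} {G : Type*} [GaugeGroup G] (ρ : Fin P.d)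

/-- A bond that is neither positive nor crossing is NEGATIVE, so its centre reflection is positive. [folklore] -/
theorem cbond_mem_posBonds_of_not {c : PBond P (j + 1)} (hs : ¬ (c.src ρ).val < P.sitesPerDir (j + 1) / 2)
    (ht : ¬ (c.tgt ρ).val < P.sitesPerDir (j + 1) / 2) : cbond ρ c ∈ posBonds P (j + 1) ρ :=
  (cbond_mem_posBonds ρ c).2 ⟨hs, ht⟩

/-- **`glue`**: the coarse field re-assembled from W3b's coordinates `w = ((y₊, y₋), z)` — positive bonds from `y₊`,
crossing bonds from `z`, negative bonds from the reflected partner `y₋` read at the centre-reflected (positive) bond,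
inverted on `ρ`-bonds. -/
def glue (w : ((↥(posBonds P (j + 1) ρ) → G) × (↥(posBonds P (j + 1) ρ) → G)) × (↥(crossBonds P (j + 1) ρ) → G)) :
    GaugeField P (j + 1) G := fun c =>
  if hs : (c.src ρ).val < P.sitesPerDir (j + 1) / 2 then
    if ht : (c.tgt ρ).val < P.sitesPerDir (j + 1) / 2 then w.1.1 ⟨c, mem_posBonds.2 ⟨hs, ht⟩⟩
    else w.2 ⟨c, mem_crossBonds.2 fun h => ht (h.1 hs)⟩
  else
    if ht : (c.tgt ρ).val < P.sitesPerDir (j + 1) / 2 then w.2 ⟨c, mem_crossBonds.2 fun h => hs (h.2 ht)⟩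
    else if c.dir = ρ then (w.1.2 ⟨cbond ρ c, cbond_mem_posBonds_of_not ρ hs ht⟩)⁻¹
    else w.1.2 ⟨cbond ρ c, cbond_mem_posBonds_of_not ρ hs ht⟩

variable (w : ((↥(posBonds P (j + 1) ρ) → G) × (↥(posBonds P (j + 1) ρ) → G)) × (↥(crossBonds P (j + 1) ρ) → G))

/-- `glue` on a positive bond reads `y₊`. [folklore] -/
theorem glue_of_mem_posBonds {c : PBond P (j + 1)} (h : c ∈ posBonds P (j + 1) ρ) : glue ρ w c = w.1.1 ⟨c, h⟩ := by
  have h' := mem_posBonds.1 h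
  simp only [glue, h'.1, h'.2, dif_pos]

/-- `glue` on a crossing bond reads `z`. [folklore] -/
theorem glue_of_mem_crossBonds {c : PBond P (j + 1)} (h : c ∈ crossBonds P (j + 1) ρ) : glue ρ w c = w.2 ⟨c, h⟩ := by
  have h' := mem_crossBonds.1 h
  unfold glue
  by_cases hs : (c.src ρ).val < P.sitesPerDir (j + 1) / 2
  · have ht : ¬ (c.tgt ρ).val < P.sitesPerDir (j + 1) / 2 := fun ht => h' ⟨fun _ => ht, fun _ => hs⟩
    rw [dif_pos hs, dif_neg ht]
  · have ht : (c.tgt ρ).val < P.sitesPerDir (j + 1) / 2 := by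
      by_contra ht; exact h' ⟨fun h => absurd h hs, fun h => absurd h ht⟩
    rw [dif_neg hs, dif_pos ht]

/-- `glue` on a negative bond reads the reflected partner `y₋` at the centre-reflected bond, inverted on `ρ`-bonds.
[folklore] -/
theorem glue_of_neg {c : PBond P (j + 1)} (hs : ¬ (c.src ρ).val < P.sitesPerDir (j + 1) / 2)
    (ht : ¬ (c.tgt ρ).val < P.sitesPerDir (j + 1) / 2) :
    glue ρ w c = if c.dir = ρ then (w.1.2 ⟨cbond ρ c, cbond_mem_posBonds_of_not ρ hs ht⟩)⁻¹
      else w.1.2 ⟨cbond ρ c, cbond_mem_posBonds_of_not ρ hs ht⟩ := by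
  simp only [glue, hs, ht, dif_neg, not_false_eq_true]

/-- `glue` is measurable (each coordinate is a coordinate of `w`, possibly inverted). [folklore] -/
theorem measurable_glue [MeasurableSpace G] [MeasurableInv G] :
    Measurable (glue (P := P) (j := j) (G := G) ρ) := by
  refine measurable_pi_lambda _ fun c => ?_
  by_cases hs : (c.src ρ).val < P.sitesPerDir (j + 1) / 2
  · by_cases ht : (c.tgt ρ).val < P.sitesPerDir (j + 1) / 2
    · simp only [glue, hs, ht, dif_pos]
      exact (measurable_pi_apply _).comp (measurable_fst.comp measurable_fst)
    · simp only [glue, hs, ht, dif_pos, dif_neg, not_false_eq_true]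
      exact (measurable_pi_apply _).comp measurable_snd
  · by_cases ht : (c.tgt ρ).val < P.sitesPerDir (j + 1) / 2
    · simp only [glue, hs, ht, dif_pos, dif_neg, not_false_eq_true]
      exact (measurable_pi_apply _).comp measurable_snd
    · by_cases hd : c.dir = ρ
      · simp only [glue, hs, ht, hd, dif_neg, not_false_eq_true, if_true]
        exact ((measurable_pi_apply _).comp (measurable_snd.comp measurable_fst)).inv
      · simp only [glue, hs, ht, hd, dif_neg, not_false_eq_true, if_false]
        exact (measurable_pi_apply _).comp (measurable_snd.comp measurable_fst)

variable {ρ w}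
variable (av : Averaging P j G)

/-- **`glue` READS BACK THE AVERAGED FIELD**: under centre-reflection equivariance (R), re-assembling W3b's
coordinates of `U` — the positive read-out, the positive read-out of `c_ρ U`, the crossing read-out — gives `av.avg U`
(negative bonds: `posRead_creflect` + `cbond_cbond` + `inv_inv`). [folklore] -/
theorem glue_reads (hR : ∀ U : GaugeField P j G, av.avg (U.creflect ρ) = (av.avg U).creflect ρ) (U : GaugeField P j G)
    (yy : (↥(posBonds P (j + 1) ρ) → G) × (↥(posBonds P (j + 1) ρ) → G)) :
    glue ρ ((posRead ρ av U, posRead ρ av (U.creflect ρ)), crossRead ρ av (U, yy)) = av.avg U := by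
  funext c
  by_cases hs : (c.src ρ).val < P.sitesPerDir (j + 1) / 2
  · by_cases ht : (c.tgt ρ).val < P.sitesPerDir (j + 1) / 2
    · rw [glue_of_mem_posBonds ρ _ (mem_posBonds.2 ⟨hs, ht⟩)]; rfl
    · rw [glue_of_mem_crossBonds ρ _ (mem_crossBonds.2 fun h => ht (h.1 hs))]; rfl
  · by_cases ht : (c.tgt ρ).val < P.sitesPerDir (j + 1) / 2
    · rw [glue_of_mem_crossBonds ρ _ (mem_crossBonds.2 fun h => hs (h.2 ht))]; rfl
    · rw [glue_of_neg ρ _ hs ht]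
      show (if c.dir = ρ then (posRead ρ av (U.creflect ρ) ⟨cbond ρ c, _⟩)⁻¹
        else posRead ρ av (U.creflect ρ) ⟨cbond ρ c, _⟩) = av.avg U c
      rw [posRead_creflect ρ av hR]
      simp only [cbond_dir, cbond_cbond]
      split_ifs <;> simp

/-- **THE COARSE REFLECTION IN W3b's COORDINATES**: `c_ρ (glue ((y₊, y₋), z)) = glue ((y₋, y₊), τ z)` — reflecting the
re-assembled field swaps the pair and applies `crossRefl` to the crossing data. [folklore] -/
theorem creflect_glue (w : ((↥(posBonds P (j + 1) ρ) → G) × (↥(posBonds P (j + 1) ρ) → G)) ×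
      (↥(crossBonds P (j + 1) ρ) → G)) :
    (glue ρ w).creflect ρ = glue ρ (w.1.swap, crossRefl ρ w.2) := by
  funext c
  rw [creflect_apply]
  have hcs := (val_cbond ρ c).1
  have hct := (val_cbond ρ c).2
  have hN := two_mul_half_sitesPerDir P (j + 1)
  have hvs := ZMod.val_lt (c.src ρ)
  have hvt := ZMod.val_lt (c.tgt ρ)
  by_cases hs : (c.src ρ).val < P.sitesPerDir (j + 1) / 2
  · by_cases ht : (c.tgt ρ).val < P.sitesPerDir (j + 1) / 2
    · -- `c` positive: `c_ρ c` negative, read from the swapped pair's second slot at `c_ρ (c_ρ c) = c`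
      have hs' : ¬ ((cbond ρ c).src ρ).val < P.sitesPerDir (j + 1) / 2 := by rw [hcs]; omega
      have ht' : ¬ ((cbond ρ c).tgt ρ).val < P.sitesPerDir (j + 1) / 2 := by rw [hct]; omega
      rw [glue_of_neg ρ _ hs' ht', glue_of_mem_posBonds ρ _ (mem_posBonds.2 ⟨hs, ht⟩)]
      have hc : (⟨cbond ρ (cbond ρ c), cbond_mem_posBonds_of_not ρ hs' ht'⟩ : ↥(posBonds P (j + 1) ρ)) =
          ⟨c, mem_posBonds.2 ⟨hs, ht⟩⟩ := Subtype.ext (cbond_cbond ρ c)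
      simp only [cbond_dir, hc, Prod.swap]
      split_ifs <;> simp
    · -- `c` crossing
      have hx : c ∈ crossBonds P (j + 1) ρ := mem_crossBonds.2 fun h => ht (h.1 hs)
      rw [glue_of_mem_crossBonds ρ _ ((cbond_mem_crossBonds ρ c).2 hx), glue_of_mem_crossBonds ρ _ hx]
      rfl
  · by_cases ht : (c.tgt ρ).val < P.sitesPerDir (j + 1) / 2
    · -- `c` crossing
      have hx : c ∈ crossBonds P (j + 1) ρ := mem_crossBonds.2 fun h => hs (h.2 ht)
      rw [glue_of_mem_crossBonds ρ _ ((cbond_mem_crossBonds ρ c).2 hx), glue_of_mem_crossBonds ρ _ hx]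
      rfl
    · -- `c` negative: `c_ρ c` positive, read from the swapped pair's first slot
      rw [glue_of_mem_posBonds ρ _ (cbond_mem_posBonds_of_not ρ hs ht), glue_of_neg ρ _ hs ht]
      rfl

end Glue

/-! ## §3 The two-level coordinates and the state identity -/

section TwoLevel

variable {P : Params} {j : ℕ} {G : Type*} [GaugeGroup G] (ρ : Fin P.d)

/-- **`twoLevel`**: W3b's carrier read in plain coordinates `(fine field, coarse field)`. -/
def twoLevel (q : (GaugeField P j G × ((↥(posBonds P (j + 1) ρ) → G) × (↥(posBonds P (j + 1) ρ) → G))) ×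
    (↥(crossBonds P (j + 1) ρ) → G)) : GaugeField P j G × GaugeField P (j + 1) G :=
  (q.1.1, glue ρ (q.1.2, q.2))

/-- `twoLevel` is measurable. [folklore] -/
theorem measurable_twoLevel [MeasurableSpace G] [MeasurableInv G] :
    Measurable (twoLevel (P := P) (j := j) (G := G) ρ) :=
  (measurable_fst.comp measurable_fst).prodMk
    ((measurable_glue ρ).comp ((measurable_snd.comp measurable_fst).prodMk measurable_snd))

/-- **`twoLevel` INTERTWINES THE REFLECTIONS**: W3d's `((c_ρ U, swap), τ z)` upstairs, `(c_ρ U, c_ρ V)` downstairs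
(`creflect_glue`). [folklore] -/
theorem twoLevel_semiconj
    (q : (GaugeField P j G × ((↥(posBonds P (j + 1) ρ) → G) × (↥(posBonds P (j + 1) ρ) → G))) ×
      (↥(crossBonds P (j + 1) ρ) → G)) :
    twoLevel ρ ((q.1.1.creflect ρ, q.1.2.swap), crossRefl ρ q.2) =
      Prod.map (GaugeField.creflect ρ) (GaugeField.creflect ρ) (twoLevel ρ q) := by
  simp only [twoLevel, Prod.map_apply, creflect_glue]

/-- **`twoLevel` READS POSITIVE DATA POSITIVELY**: it is measurable from W3d's positive σ-algebra (positive fine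
bonds + the positive read-out `y₊`) to `(mPos G j ρ).prod (mPos G (j+1) ρ)` (positive fine bonds + positive coarse
bonds) — on a positive coarse bond `glue` reads `y₊` (`glue_of_mem_posBonds`). [folklore] -/
theorem measurable_twoLevel_pos [MeasurableSpace G] :
    @Measurable _ _
      ((((mPos G j ρ).prod (inferInstance : MeasurableSpace (↥(posBonds P (j + 1) ρ) → G))).comap
          (fun p : GaugeField P j G × ((↥(posBonds P (j + 1) ρ) → G) × (↥(posBonds P (j + 1) ρ) → G)) =>
            (p.1, p.2.1))).comap Prod.fst)
      ((mPos G j ρ).prod (mPos G (j + 1) ρ)) (twoLevel (P := P) (j := j) (G := G) ρ) := by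
  -- the positive coordinates `(U, y₊)` are measurable for W3d's positive σ-algebra by construction
  have hΦ₀ : @Measurable _ _
      ((((mPos G j ρ).prod (inferInstance : MeasurableSpace (↥(posBonds P (j + 1) ρ) → G))).comap
          (fun p : GaugeField P j G × ((↥(posBonds P (j + 1) ρ) → G) × (↥(posBonds P (j + 1) ρ) → G)) =>
            (p.1, p.2.1))).comap Prod.fst)
      ((mPos G j ρ).prod (inferInstance : MeasurableSpace (↥(posBonds P (j + 1) ρ) → G)))
      (fun q : (GaugeField P j G × ((↥(posBonds P (j + 1) ρ) → G) × (↥(posBonds P (j + 1) ρ) → G))) ×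
        (↥(crossBonds P (j + 1) ρ) → G) => (q.1.1, q.1.2.1)) := by
    rw [MeasurableSpace.comap_comp]
    exact comap_measurable _
  have h1 := (@measurable_fst _ _ (mPos G j ρ)
    (inferInstance : MeasurableSpace (↥(posBonds P (j + 1) ρ) → G))).comp hΦ₀
  have h2 := (@measurable_snd _ _ (mPos G j ρ)
    (inferInstance : MeasurableSpace (↥(posBonds P (j + 1) ρ) → G))).comp hΦ₀
  refine @Measurable.prodMk _ _ _ _ (mPos G j ρ) (mPos G (j + 1) ρ) _ _ h1 ?_
  -- the coarse positive coordinates of `glue` are coordinates of `y₊`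
  refine measurable_comap_iff.2 (@measurable_pi_lambda _ _ _ (_) _ _ fun c => ?_)
  have hc : (c : PBond P (j + 1)) ∈ posBonds P (j + 1) ρ := Finset.mem_coe.1 c.2
  show @Measurable _ _ (_) _ fun q : (GaugeField P j G × ((↥(posBonds P (j + 1) ρ) → G) ×
      (↥(posBonds P (j + 1) ρ) → G))) × (↥(crossBonds P (j + 1) ρ) → G) => glue ρ (q.1.2, q.2) (c : PBond P (j + 1))
  have key : (fun q : (GaugeField P j G × ((↥(posBonds P (j + 1) ρ) → G) × (↥(posBonds P (j + 1) ρ) → G))) ×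
      (↥(crossBonds P (j + 1) ρ) → G) => glue ρ (q.1.2, q.2) (c : PBond P (j + 1))) = fun q => q.1.2.1 ⟨c, hc⟩ :=
    funext fun q => glue_of_mem_posBonds ρ _ hc
  rw [key]
  exact (measurable_pi_apply _).comp h2

variable (av : Averaging P j G)

/-- **THE STATE IDENTITY**: the δ-extended one-level state of W3b∕W3d∕W3f, read in plain coordinates, IS the two-level
law `μ.map (U ↦ (U, av.avg U))` (Mathlib `Measure.compProd_deterministic`, W3d's `pairKernel_deterministic`,
`glue_reads`). [folklore] -/
theorem map_twoLevel [MeasurableSpace G] [MeasurableInv G] (hA : Measurable av.avg)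
    (hR : ∀ U : GaugeField P j G, av.avg (U.creflect ρ) = (av.avg U).creflect ρ) (μ : Measure (GaugeField P j G))
    [SFinite μ] :
    ((μ ⊗ₘ ((Kernel.deterministic (posRead ρ av) (measurable_posRead ρ av hA)) ×ₖ
        (Kernel.deterministic (posRead ρ av) (measurable_posRead ρ av hA)).comap (GaugeField.creflect ρ)
          (measurable_creflect ρ))) ⊗ₘ
      Kernel.deterministic (crossRead ρ av) (measurable_crossRead ρ av hA)).map (twoLevel ρ) =
    μ.map fun U => (U, av.avg U) := by
  have hf := measurable_posRead ρ av hA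
  have hg := measurable_crossRead ρ av hA
  have hm1 : Measurable fun a : GaugeField P j G => (a, (posRead ρ av a, posRead ρ av (GaugeField.creflect ρ a))) :=
    measurable_id.prodMk (hf.prodMk (hf.comp (measurable_creflect ρ)))
  have hm2 : Measurable fun a : GaugeField P j G × ((↥(posBonds P (j + 1) ρ) → G) × (↥(posBonds P (j + 1) ρ) → G)) =>
      (a, crossRead ρ av a) := measurable_id.prodMk hg
  rw [HistoryRPDeterministic.pairKernel_deterministic (measurable_creflect ρ) hf,
    Measure.compProd_deterministic, Measure.compProd_deterministic]
  show Measure.map (twoLevel ρ) (Measure.map (fun a : GaugeField P j G × ((↥(posBonds P (j + 1) ρ) → G) ×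
      (↥(posBonds P (j + 1) ρ) → G)) => (a, crossRead ρ av a))
      (Measure.map (fun a : GaugeField P j G => (a, (posRead ρ av a, posRead ρ av (GaugeField.creflect ρ a)))) μ)) =
    Measure.map (fun U => (U, av.avg U)) μ
  rw [Measure.map_map hm2 hm1, Measure.map_map (measurable_twoLevel ρ) (hm2.comp hm1)]
  congr 1
  funext U
  simp only [Function.comp_apply, twoLevel, glue_reads av hR]

end TwoLevel

/-! ## §4 The two-level RP-package -/

section Package

variable {P : Params} {j : ℕ} {G : Type*} [GaugeGroup G] [MeasurableSpace G]

/-- **THE TWO-LEVEL LAW IS REFLECTION POSITIVE** (abstract form): for a measurable one-step averaging `av` that is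
two-block local (tree `TwoBlockLocal`) and centre-reflection equivariant, and a base state `μ` on the fine fields that
is `c_ρ`-invariant and reflection positive for the positive fine bonds, the joint law `μ.map (U ↦ (U, av.avg U))` on
`GaugeField P j G × GaugeField P (j+1) G` carries the FIVE-member RP-package for the positive fine + coarse bonds
`(mPos G j ρ).prod (mPos G (j+1) ρ)` and the reflection `(U, V) ↦ (c_ρ U, c_ρ V)`.  (= W3f's package transported along
`twoLevel`, §1–§3.) [folklore] -/
theorem rpPackage_twoLevel [MeasurableInv G] (hj : j + 1 ≤ P.m + P.K) (ρ : Fin P.d) {av : Averaging P j G}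
    (hA : Measurable av.avg) (hL : TwoBlockLocal av)
    (hR : ∀ U : GaugeField P j G, av.avg (U.creflect ρ) = (av.avg U).creflect ρ)
    {μ : Measure (GaugeField P j G)} [IsFiniteMeasure μ]
    (hθ : MeasurePreserving (GaugeField.creflect ρ) μ μ)
    (hRP : IsReflectionPositiveBdd μ (mPos G j ρ) (GaugeField.creflect ρ)) :
    (mPos G j ρ).prod (mPos G (j + 1) ρ) ≤
        (inferInstance : MeasurableSpace (GaugeField P j G × GaugeField P (j + 1) G)) ∧
      Measurable (Prod.map (GaugeField.creflect ρ) (GaugeField.creflect ρ) :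
        GaugeField P j G × GaugeField P (j + 1) G → GaugeField P j G × GaugeField P (j + 1) G) ∧
      MeasurePreserving (Prod.map (GaugeField.creflect ρ) (GaugeField.creflect ρ))
        (μ.map fun U => (U, av.avg U)) (μ.map fun U => (U, av.avg U)) ∧
      ((Prod.map (GaugeField.creflect ρ) (GaugeField.creflect ρ) :
          GaugeField P j G × GaugeField P (j + 1) G → GaugeField P j G × GaugeField P (j + 1) G) ∘
        Prod.map (GaugeField.creflect ρ) (GaugeField.creflect ρ) = id) ∧
      IsReflectionPositiveBdd (μ.map fun U => (U, av.avg U)) ((mPos G j ρ).prod (mPos G (j + 1) ρ))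
        (Prod.map (GaugeField.creflect ρ) (GaugeField.creflect ρ)) := by
  have hΘ' : Measurable (Prod.map (GaugeField.creflect ρ) (GaugeField.creflect ρ) :
      GaugeField P j G × GaugeField P (j + 1) G → GaugeField P j G × GaugeField P (j + 1) G) :=
    (measurable_creflect ρ).prodMap (measurable_creflect ρ)
  have hle : (mPos G j ρ).prod (mPos G (j + 1) ρ) ≤
      (inferInstance : MeasurableSpace (GaugeField P j G × GaugeField P (j + 1) G)) :=
    prod_le_prod (mPos_le G j ρ) (mPos_le G (j + 1) ρ)
  have hι : Measurable fun U : GaugeField P j G => (U, av.avg U) := measurable_id.prodMk hA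
  refine ⟨hle, hΘ', ?_, ?_, ?_⟩
  · exact measurePreserving_map_of_semiconj hθ hΘ' hι fun U => by
      simp only [Prod.map_apply, hR]
  · funext p
    obtain ⟨U, V⟩ := p
    show (GaugeField.creflect ρ (GaugeField.creflect ρ U), GaugeField.creflect ρ (GaugeField.creflect ρ V)) = (U, V)
    rw [creflect_creflect, creflect_creflect]
  · have h5 := (rpPackage_level_of_local_equivariant hj ρ hA hL hR hθ hRP).2.2.2.2
    rw [← map_twoLevel ρ av hA hR μ]
    exact isReflectionPositiveBdd_map hle hΘ' (measurable_twoLevel ρ) (measurable_twoLevel_pos ρ)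
      (twoLevel_semiconj ρ) h5

/-- **THE TWO-LEVEL LAW OF BAŁABAN'S BLOCK AVERAGING (0.4) IS REFLECTION POSITIVE AT THE CENTRE CUT** (tree
`blockAvg ℰ`, any small-loop average `ℰ` with measurable `E`): from a `c_ρ`-invariant, reflection-positive fine state
`μ`, the joint law of the fine field and its block average, `μ.map (U ↦ (U, (blockAvg ℰ).avg U))`, carries the
RP-package for the positive fine + coarse bonds and `(U, V) ↦ (c_ρ U, c_ρ V)` — (LOC) by `twoBlockLocal_blockAvg`, (γ) by
`blockAvg_creflect`, both tree theorems. [folklore] -/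
theorem rpPackage_twoLevel_blockAvg [RegularGaugeGroup G] (hj : j + 1 ≤ P.m + P.K) (ρ : Fin P.d)
    (ℰ : LoopAverage G) (hE : ∀ n, Measurable fun W : Fin (n + 1) → G => ℰ.E W)
    {μ : Measure (GaugeField P j G)} [IsFiniteMeasure μ]
    (hθ : MeasurePreserving (GaugeField.creflect ρ) μ μ)
    (hRP : IsReflectionPositiveBdd μ (mPos G j ρ) (GaugeField.creflect ρ)) :
    (mPos G j ρ).prod (mPos G (j + 1) ρ) ≤
        (inferInstance : MeasurableSpace (GaugeField P j G × GaugeField P (j + 1) G)) ∧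
      Measurable (Prod.map (GaugeField.creflect ρ) (GaugeField.creflect ρ) :
        GaugeField P j G × GaugeField P (j + 1) G → GaugeField P j G × GaugeField P (j + 1) G) ∧
      MeasurePreserving (Prod.map (GaugeField.creflect ρ) (GaugeField.creflect ρ))
        (μ.map fun U => (U, (blockAvg (P := P) (j := j) ℰ).avg U))
        (μ.map fun U => (U, (blockAvg (P := P) (j := j) ℰ).avg U)) ∧
      ((Prod.map (GaugeField.creflect ρ) (GaugeField.creflect ρ) :
          GaugeField P j G × GaugeField P (j + 1) G → GaugeField P j G × GaugeField P (j + 1) G) ∘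
        Prod.map (GaugeField.creflect ρ) (GaugeField.creflect ρ) = id) ∧
      IsReflectionPositiveBdd (μ.map fun U => (U, (blockAvg (P := P) (j := j) ℰ).avg U))
        ((mPos G j ρ).prod (mPos G (j + 1) ρ)) (Prod.map (GaugeField.creflect ρ) (GaugeField.creflect ρ)) :=
  rpPackage_twoLevel hj ρ (measurable_avgFun ℰ hE) (twoBlockLocal_blockAvg ℰ) (blockAvg_creflect ℰ ρ) hθ hRP

end Package

end

end Summit.QuantumFields.BalabanUV.T4Continuum.HistoryRPTwoLevel
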